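import Summits.CriticalPhenomena.PercolationContinuityZ3.Theorems.Transplant.SkelFrmQuasiBChoiceAtQT
import Summits.CriticalPhenomena.PercolationContinuityZ3.Theorems.Transplant.SkelFrmQuasiBChoiceLinksPx
import Summits.CriticalPhenomena.PercolationContinuityZ3.Theorems.Transplant.PlanarSkeletonFrmQuasiDefs
import Summits.CriticalPhenomena.PercolationContinuityZ3.Theorems.Transplant.PlanarSkeletonFrmQuasiProx
import Summits.CriticalPhenomena.PercolationContinuityZ3.Theorems.Transplant.PlanarSkeletonFrmQuasiProxies
import Summits.CriticalPhenomena.PercolationContinuityZ3.Theorems.Transplant.SkelFrmQuasi1ChoiceDefs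
import Summits.CriticalPhenomena.PercolationContinuityZ3.Theorems.Transplant.SkelFrmQuasi1ParamsPO
import Summits.CriticalPhenomena.PercolationContinuityZ3.Theorems.Transplant.SkelFrmQuasi1SlotTypes
import Summits.CriticalPhenomena.PercolationContinuityZ3.Theorems.Transplant.SkelFrmQuasiBChoiceDefs
import Summits.CriticalPhenomena.PercolationContinuityZ3.Theorems.Transplant.SkelFrmQuasiBChoiceDefsT
import Summits.CriticalPhenomena.PercolationContinuityZ3.Theorems.Transplant.SkelFrmQuasiBChoiceKitPx
import Summits.CriticalPhenomena.PercolationContinuityZ3.Theorems.Transplant.SkelFrmQuasi1SlotTypes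
import HarnessLib

/-!
# GEN-Q PORT (WAVE-Q table v0.8 section 2, row G262, U-level L?; captain R-6/R-7 2026-08-27: carrier token swap `PlanarSkeletonFrmFrom ↦ PlanarSkeletonFrmQuasi`)
# of the tree module «Transplant/SkelFrmFromBChoiceAtQTPx» (sha256 a55aaa5a6d082aea…) onto the quasi-step carrier `PlanarSkeletonFrmQuasi` (p507026): «SkelFrmQuasiBChoiceAtQTPx»

ORIGINAL TITLE: 

builds on p205010 (kernel theorem, internal audit signed; external expert review pending) — nothing in this file uses p205010; NOTHING is claimed about any open node
((N3-b), the end state).  Lane `prim-bschramm`, seat `prim-bschramm-p3` (gen 30; design owner; tool = captain gen-1 g4's port_genq.py R-14 --cone + p3-g30 slot-value patch T1).  Helper file (`--supports stmt-CriticalPhenomena-4575 --as helper`).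
PORT RULES (U-wave r1–r4 re-used, GEN-Q hunk classes of p3-g29 #6136): declaration order, names and proof texts are those of «SkelFrmFromBChoiceAtQTPx», byte-identical except
(i) the carrier token `PlanarSkeletonFrmFrom ↦ PlanarSkeletonFrmQuasi` in binders, `namespace`/`end` lines and qualified names (module names `SkelFrmFrom… ↦ SkelFrmQuasi…`
in imports of already-ported rows); (ii) `Φ.step ↦ Φ.qstep` with the called Steps lemma replaced by its `…Q`/`_q` twin and the cost `Φ.M` threaded (none in this file unless
listed below); (iii) `Φ.cyl_connected ↦ Φ.cyl_reach` readers (none unless listed); (iv) graph-ball radii / window floors ×`Φ.M` (none unless listed).  Carrier-free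
residents stay imported/exported from the original «SkelFrmBChoiceAtQTPx» exactly as in the FrmFrom port.  Docstrings and citations are the original's.

-/

noncomputable section

open scoped Classical

namespace Summit.CriticalPhenomena.PercolationContinuityZ3.Theorems.Transplant

open MeasureTheory Literature.Probability.Percolation Literature.Probability.LatticeModels SimpleGraph KNCells KNLevels
open SkelConc (Consts)
open Skelφ (oriφ trφ)
open Skelφ.StepI (DataN DataNS OutNS famSign)

namespace PlanarSkeletonFrmQuasi

namespace NegB

open Neg


-- GEN-Q T3 (p3-g30): residents/aliases of the row-less module(s) «SkelFrmFromBParamsKitA» used below, re-exported here.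
export PlanarSkeletonFrmFrom.NegB (nKit)

section AtQTPx

variable {κ : Consts} {V : Type} [DecidableEq V] [Countable V] {G : SimpleGraph V} [G.LocallyFinite] {Φ : PlanarSkeletonFrmQuasi G} {t : V} {p : unitInterval}
  {hC : Φ.CylSubcritical p} {gv fv : Neg.FSlot} {Pv : PSlot} {Sv : SSlot} {cv : CSlot} {bv : BSlot} {O : OutNS V} {q : unitInterval} {D : ℕ}
-- GEN-Q (R-2, captain 2026-08-27): `PlanarSkeletonFrmFrom.NegB.inputsPAt_of_atQTPx` is not in the used cone of the node top — not ported.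

-- GEN-Q (R-2, captain 2026-08-27): `PlanarSkeletonFrmFrom.NegB.inputsExtraAt_of_atQTPx` is not in the used cone of the node top — not ported.

-- GEN-Q (R-2, captain 2026-08-27): `PlanarSkeletonFrmFrom.NegB.inputsSAt_of_atQTPx` is not in the used cone of the node top — not ported.

-- GEN-Q (R-2, captain 2026-08-27): `PlanarSkeletonFrmFrom.NegB.inputsLAt_of_atQTPx` is not in the used cone of the node top — not ported.

-- GEN-Q (R-2, captain 2026-08-27): `PlanarSkeletonFrmFrom.NegB.zoneAt_of_atQTPx` is not in the used cone of the node top — not ported.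

-- GEN-Q (R-2, captain 2026-08-27): `PlanarSkeletonFrmFrom.NegB.inputsLAt_cube_of_atQTPx` is not in the used cone of the node top — not ported.

-- GEN-Q (R-2, captain 2026-08-27): `PlanarSkeletonFrmFrom.NegB.inputsSAt_cube_of_atQTPx` is not in the used cone of the node top — not ported.

/-- [UNDER PROXIES: data `toDataN.proxR prox D` / zone `Λ ∘ prox` / radius `+ D`, width floor] (R-40) T twin at `choiceAtQ3T` (one-liner over the S lemma `inputsPAt_cube_of_atQ`): **Any listed pair's piece-links at every centre at accuracy `1 − a³`** (`a ≥ δkit`; served near sign; in particular the kit pair when `(MK, nKit) ∈ Pv`).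
[cite: KozmaNitzan2024, §4 pp. 19–21] -/
theorem inputsPAt_cube_of_atQTPx {κ : Consts} {V : Type} [DecidableEq V] [Countable V] {G : SimpleGraph V} [G.LocallyFinite] {Φ : PlanarSkeletonFrmQuasi G} {t : V} {p : unitInterval} {hC : Φ.CylSubcritical p} {gv : Neg.FSlot} {fv : Neg.FSlot} {Pv : PSlot} {Sv : SSlot} {cv : CSlot} {bv : BSlot} {O : OutNS V} {q : unitInterval} {D : ℕ} (hAt : (choiceAtQ3T κ Φ t p Pv gv fv Sv cv bv hC).AtQNQ O q) (hP : Φ.HasProxies t D) {a : ℝ} (ha : Neg.δkit κ Φ ≤ a) (c : V) {M n : ℕ}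
    (hMn : (M, n) ∈ SMnP κ Φ t p O.merged (gOf κ Φ t p O gv) (fOf κ Φ t p O fv) Pv) (hn : D ≤ n) (fam : Fin 2) (τ : ℤˣ) :
    1 - a ^ 3 < (bondPercolation G q).real
      (Skelφ.StepI.eventNAt G (Skelφ.oriφ Φ.φ (O.ori t M n)) (O.merged.toDataN.proxR hP.prox D) t c (M, some (n, fam, Skelφ.StepI.sgQ O.qd O.qdT O.ori t M n fam, τ))) :=
  inputsPAt_cube_of_atQPx (hAt := choiceAtQ3T_atQNQ_iff.1 hAt) (hP := hP) (hn := hn) (ha := ha) (c := c) (hMn := hMn) (fam := fam) (τ := τ)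


-- GEN-Q (R-2, captain 2026-08-27): `PlanarSkeletonFrmFrom.NegB.zoneAt_cube_of_atQTPx` is not in the used cone of the node top — not ported.

-- GEN-Q (R-2, captain 2026-08-27): `PlanarSkeletonFrmFrom.NegB.hlong_of_atQ3TPx` is not in the used cone of the node top — not ported.

-- GEN-Q (R-2, captain 2026-08-27): `PlanarSkeletonFrmFrom.NegB.hlongY_of_atQ3TPx` is not in the used cone of the node top — not ported.

end AtQTPx

end NegB

end PlanarSkeletonFrmQuasi

end Summit.CriticalPhenomena.PercolationContinuityZ3.Theorems.Transplant

end
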